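import Summits.BirchSwinnertonDyer.BirchSwinnertonDyer.Theorems.ByReductionTypeAtTwoMultUpperHalfTowerNonsplit
import Summits.BirchSwinnertonDyer.BirchSwinnertonDyer.Theorems.ByReductionTypeAtTwoMultTowerNS2LayerZeroEulerChar
import Literature.NumberTheory.EllipticCurves.MazurTorsionOrderValuationProofs
import HarnessLib

/-!
# Route `ByReductionTypeAtTwo`, crux `MultUpperHalfAtTwo` (item stmt-BirchSwinnertonDyer-19922): the TOWER road at a
# NON-SPLIT multiplicative `2` for an `E[2]`-IRREDUCIBLE member — the Thm-4.1-analogue binder `h41ns'` DISCHARGED by the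
# kernel theorem `MultTowerNS2LayerZero.twoAdicEulerCharRankZeroNonsplitMult_of_noTwoTorsion` (and the idle A236 binder dropped)

HONEST FRAMING (cell `bsd-2adic`, run/shared/lean/pub/bsd-2adic/, seat `bsd-2adic-tower-1` GEN 30, HUMAN RULINGS
D-0036 / D-0054 / D-0074): THEOREMS ONLY (no definition, no named fact, no `sorry`); closes no item; nothing booked; no
class display re-keyed (D-0152 — the per-class files keep citing the GEN 6 door with `h41ns'`; passing to these doors is
the planner's call); BSD is not proved by any of this. PARTITION: X5@2 mult (K4ᵐ 19922), NON-SPLIT `E[2]`-irreducible rows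
× p = 2 — types-the-object-of; closes none.

The GEN 6 non-split class door `missingUpperBoundAt_two_nonsplit_of_towerGapMember'` displays, among its PRINT binders, the
guarded Thm-4.1 analogue `h41ns' : Greenberg1999.thm41Analogue_charValue_rankZero_numberField_anyPrime_oddLocalDegree`,
consumed only as `O1.TwoAdicEulerCharRankZeroNonsplitMult W₁ 0` at the certified member. GEN 30 proved that display for
every globally minimal elliptic `W₁/ℚ` with `E(ℚ)[2] = 0` (`…LayerZeroEulerChar`, Greenberg LNM 1716 p. 113 «If p = 2, then
`|ker(r_v)| = 2c_v^{(p)}`» made kernel at the layer `0`); an `E[2]`-IRREDUCIBLE member has no rational `2`-torsion. Hence: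

* `twoAdicEulerCharRankZeroNonsplitMult_zero_of_irr` — `Irr W 2 ⟹ O1.TwoAdicEulerCharRankZeroNonsplitMult W 0` (kernel);
* `missingUpperBoundAt_two_nonsplit_of_towerGap_of_eulerChar_nonsplitRoad` — per member, the NON-SPLIT branch of road (i)
  (`O1.missingUpperBoundAt_two_nonsplit_of_mu_eq_zero_auto`) fed with `μ = 0` from the tower-gap certificate: no
  Greenberg–Stevens binder AND no A236 binder `h41sp` (both belong to the split branch of the either-sign road-(i) door);
* `missingUpperBoundAt_two_nonsplit_of_towerGapMember_irr` — the class door WITHOUT `h41ns'` and WITHOUT `h41sp`: PRINT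
  {`hmod`, `hGZK`, `hCassels`, `hC`} + MEMO {`hKato` K11a} + the certificate `O1.TowerGapAtTwo W₁` at an `E[2]`-irreducible
  NON-SPLIT member `W₁ ~_ℚ W`;
* `missingUpperBoundAt_two_nonsplit_of_towerGapMember_irr_of_katoRatAt` — the same with Kato's divisibility displayed at the
  certified member only.

References: R. Greenberg, LNM 1716 (1999), §3 pp. 85–94, §4 pp. 112–113; K. Kato, Astérisque 295 (2004), Thm. 17.4, §17.13;
K. Česnavičius (2018) Thm. 1.2; J. W. S. Cassels, Arithmetic VIII (1965); B. Mazur, IHÉS 47 (1977), III §5.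
-/

set_option autoImplicit false
-- the Theorems namespace of this sub repeats the summit name by design (D-0017 nested layout: Summit.<S>.<Sub>)
set_option linter.dupNamespace false

noncomputable section

open scoped Classical MatrixGroups ModularForm

open NumberField IsDedekindDomain CongruenceSubgroup WeierstrassCurve Literature.NumberTheory.EllipticCurves
  Literature.NumberTheory.EllipticCurves.ModularForms
  Literature.NumberTheory.EllipticCurves.Greenberg1999
  Literature.NumberTheory.EllipticCurves.Rank1Residual
  Literature.NumberTheory.EllipticCurves.Rank1Residual.Typed
  Summit.BirchSwinnertonDyer.Rank1Residual.X5

namespace Summit.BirchSwinnertonDyer.BirchSwinnertonDyer.Theorems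

/-! ## §1 The control display at an `E[2]`-irreducible curve, kernel -/

/-- **`Irr W 2 ⟹ O1.TwoAdicEulerCharRankZeroNonsplitMult W 0` — KERNEL.** An `E[2]`-irreducible curve has no rational point
of order `2` (such a point gives `2 ∣ #E(ℚ)_tors`, `dvd_torsionOrder_of_nsmul_eq_zero`, contradicting irreducibility,
`not_hasIrreducibleModPGaloisRep_of_dvd_torsionOrder`), so GEN 30's
`MultTowerNS2LayerZero.twoAdicEulerCharRankZeroNonsplitMult_of_noTwoTorsion` applies.
[cite: GreenbergLNM1716, §4 pp. 112–113] [cite: Mazur1977, Ch. III §5, p. 157] -/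
theorem twoAdicEulerCharRankZeroNonsplitMult_zero_of_irr (W : WeierstrassCurve ℚ) [W.IsElliptic] [W.IsGloballyMinimal]
    (hirr : Irr W 2) : O1.TwoAdicEulerCharRankZeroNonsplitMult W 0 :=
  MultTowerNS2LayerZero.twoAdicEulerCharRankZeroNonsplitMult_of_noTwoTorsion W fun P hP ↦ by
    by_contra h0
    exact not_hasIrreducibleModPGaloisRep_of_dvd_torsionOrder W 2 (dvd_torsionOrder_of_nsmul_eq_zero W 2 hP h0) hirr

/-! ## §2 Per member: the non-split branch of road (i) from a tower-gap certificate (no `hGS`, no `h41sp`) -/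

/-- **ROAD (tower) per member at a NON-SPLIT `2`, `hEC`-abstract, GS-free AND A236-free.** For a globally minimal elliptic
`W/ℚ` of analytic rank `0`, multiplicative and NON-SPLIT at `2`: Kato's divisibility `⊗ℚ` at `2` (`hKato`, MEMO K11a), the
non-split control display `hEC`, modularity, GZK, the period datum `0 ≤ ord₂ ϖ` and a tower-gap certificate
`O1.TowerGapAtTwo W` ⟹ `MissingUpperBoundAt W 2` — the non-split branch `O1.missingUpperBoundAt_two_nonsplit_of_mu_eq_zero_auto`
of the either-sign road-(i) door `missingUpperBoundAt_two_mult_of_mu_eq_zero_of_eulerChar`, with `μ = 0` from the certificate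
(`mu_eq_zero_of_towerGapAtTwo`); the A236 binder `h41sp` of the GEN 6 door only serves the split branch.
[cite: GreenbergLNM1716, §4 pp. 112–113] [cite: Kato2004Asterisque, Thm. 17.4 (p. 273) and 17.13] [cite: Washington1997, §13.2]
[cite: Miller2011LMS, Def. 1.1] -/
theorem missingUpperBoundAt_two_nonsplit_of_towerGap_of_eulerChar_nonsplitRoad (W : WeierstrassCurve ℚ) [W.IsElliptic]
    [W.IsGloballyMinimal] (hKato : O1.KatoMultiplicativeDivisibilityRat W 2)
    (hEC : O1.TwoAdicEulerCharRankZeroNonsplitMult W 0)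
    (hmod : nonempty_modularParametrizationData)
    (hGZK : rank_eq_analyticRank_of_analyticRank_le_one)
    (hper₀ : ∀ [NeZero (W.conductorNorm ℤ)] (f : CuspForm (Gamma0 (W.conductorNorm ℤ)) 2),
      IsNewformOf W f → ∀ ϖ : ℚ, (ϖ : ℝ) * W.realPeriodRat = plusPeriod f → 0 ≤ padicValRat 2 ϖ)
    (hgap : O1.TowerGapAtTwo W) (hr : W.analyticRank = 0) (hmult : Mult W 2)
    (hns : ¬ W.HasSplitMultiplicativeReductionAtPrime 2) :
    MissingUpperBoundAt W 2 :=
  O1.missingUpperBoundAt_two_nonsplit_of_mu_eq_zero_auto W hEC hmod hGZK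
    (fun f L => O1.katoDivisibilityAtTwoNonsplitMultRat_of_multRat W hKato f L) (mu_eq_zero_of_towerGapAtTwo W hgap)
    hper₀ hr hmult hns

/-! ## §3 The class theorem at an `E[2]`-irreducible NON-SPLIT member, without `h41ns'` and `h41sp` -/

/-- **ROAD (tower) for the CLASS from an `E[2]`-IRREDUCIBLE NON-SPLIT member, GS-free and `h41ns'`-FREE.** For `W` of analytic
rank `0` multiplicative at `2` and an isogenous globally minimal member `W₁ ~_ℚ W`, NON-SPLIT multiplicative at `2`, with
`Irr W₁ 2` and a tower-gap certificate `O1.TowerGapAtTwo W₁`: `MissingUpperBoundAt W 2`, from PRINT {`hmod`, `hGZK`, `hCassels`,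
`hC`} + MEMO {`hKato` K11a}. The GEN 6 door `missingUpperBoundAt_two_nonsplit_of_towerGapMember'` with its binder `h41ns'`
replaced by the kernel term `twoAdicEulerCharRankZeroNonsplitMult_zero_of_irr W₁ hirr₁`, its idle A236 binder dropped (§2),
and the period datum on the `Irr` branch (Česnavičius `hC`).
[cite: GreenbergLNM1716, §3 Note (p. 93) and §4 pp. 112–113] [cite: Kato2004Asterisque, Thm. 17.4 and §17.13]
[cite: Cesnavicius2018, Thm. 1.2] [cite: Cassels1965ArithmeticVIII] [cite: Miller2011LMS, Def. 1.1] -/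
theorem missingUpperBoundAt_two_nonsplit_of_towerGapMember_irr
    (hKato : ∀ (W : WeierstrassCurve ℚ) [W.IsElliptic] [W.IsGloballyMinimal],
      ¬ W.HasCM → Mult W 2 → O1.KatoMultiplicativeDivisibilityRat W 2)
    (hmod : nonempty_modularParametrizationData)
    (hGZK : rank_eq_analyticRank_of_analyticRank_le_one)
    (hCassels : bsdRHS_eq_of_isIsogenous)
    (hC : cesnavicius_not_two_dvd_maninConstant_of_two_dvd_level)
    (W : WeierstrassCurve ℚ) [W.IsElliptic] [W.IsGloballyMinimal]
    (hr : W.analyticRank = 0) (hmult : Mult W 2)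
    (W₁ : WeierstrassCurve ℚ) [W₁.IsElliptic] [W₁.IsGloballyMinimal] (hiso : IsIsogenous W W₁)
    (hns₁ : ¬ W₁.HasSplitMultiplicativeReductionAtPrime 2)
    (hgap : O1.TowerGapAtTwo W₁) (hirr₁ : Irr W₁ 2) :
    MissingUpperBoundAt W 2 := by
  have hmult₁ : Mult W₁ 2 :=
    Summit.BirchSwinnertonDyer.Rank1Residual.X2.IsogenyQuotientLine.hasMultiplicativeReductionAtPrime_of_isIsogenous
      hiso hmult
  have hr₁ : W₁.analyticRank = 0 := (analyticRank_eq_of_isIsogenous' hiso).symm.trans hr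
  have hcm₁ : ¬ W₁.HasCM := fun h ↦ Rank1Residual.not_mult_of_hasCM W₁ h 2 hmult₁
  have hper₁ : ∀ [NeZero (W₁.conductorNorm ℤ)] (f : CuspForm (Gamma0 (W₁.conductorNorm ℤ)) 2),
      IsNewformOf W₁ f → ∀ ϖ : ℚ, (ϖ : ℝ) * W₁.realPeriodRat = plusPeriod f → 0 ≤ padicValRat 2 ϖ :=
    fun f hf ϖ hϖ ↦ (padicValRat_periodRatio_eq_zero_of_irr_two hC W₁ hmult₁ hirr₁ f hf ϖ hϖ).ge
  have hU₁ : MissingUpperBoundAt W₁ 2 :=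
    missingUpperBoundAt_two_nonsplit_of_towerGap_of_eulerChar_nonsplitRoad W₁ (hKato W₁ hcm₁ hmult₁)
      (twoAdicEulerCharRankZeroNonsplitMult_zero_of_irr W₁ hirr₁) hmod hGZK hper₁ hgap hr₁ hmult₁ hns₁
  exact missingUpperBoundAt_two_of_isogenous_member hmod hGZK hCassels W hr W₁ hiso hU₁

/-- **The same with Kato's divisibility displayed AT THE CERTIFIED MEMBER only** (`hKato₁ : O1.KatoMultiplicativeDivisibilityRat W₁ 2`).
[cite: Kato2004Asterisque, Thm. 17.4 and §17.13] [cite: GreenbergLNM1716, §4 pp. 112–113] [cite: Cassels1965ArithmeticVIII]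
[cite: Cesnavicius2018, Thm. 1.2] [cite: Miller2011LMS, Def. 1.1] -/
theorem missingUpperBoundAt_two_nonsplit_of_towerGapMember_irr_of_katoRatAt
    (hmod : nonempty_modularParametrizationData)
    (hGZK : rank_eq_analyticRank_of_analyticRank_le_one)
    (hCassels : bsdRHS_eq_of_isIsogenous)
    (hC : cesnavicius_not_two_dvd_maninConstant_of_two_dvd_level)
    (W : WeierstrassCurve ℚ) [W.IsElliptic] [W.IsGloballyMinimal]
    (hr : W.analyticRank = 0) (hmult : Mult W 2)
    (W₁ : WeierstrassCurve ℚ) [W₁.IsElliptic] [W₁.IsGloballyMinimal] (hiso : IsIsogenous W W₁)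
    (hKato₁ : O1.KatoMultiplicativeDivisibilityRat W₁ 2)
    (hns₁ : ¬ W₁.HasSplitMultiplicativeReductionAtPrime 2)
    (hgap : O1.TowerGapAtTwo W₁) (hirr₁ : Irr W₁ 2) :
    MissingUpperBoundAt W 2 := by
  have hmult₁ : Mult W₁ 2 :=
    Summit.BirchSwinnertonDyer.Rank1Residual.X2.IsogenyQuotientLine.hasMultiplicativeReductionAtPrime_of_isIsogenous
      hiso hmult
  have hr₁ : W₁.analyticRank = 0 := (analyticRank_eq_of_isIsogenous' hiso).symm.trans hr
  have hper₁ : ∀ [NeZero (W₁.conductorNorm ℤ)] (f : CuspForm (Gamma0 (W₁.conductorNorm ℤ)) 2),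
      IsNewformOf W₁ f → ∀ ϖ : ℚ, (ϖ : ℝ) * W₁.realPeriodRat = plusPeriod f → 0 ≤ padicValRat 2 ϖ :=
    fun f hf ϖ hϖ ↦ (padicValRat_periodRatio_eq_zero_of_irr_two hC W₁ hmult₁ hirr₁ f hf ϖ hϖ).ge
  have hU₁ : MissingUpperBoundAt W₁ 2 :=
    missingUpperBoundAt_two_nonsplit_of_towerGap_of_eulerChar_nonsplitRoad W₁ hKato₁
      (twoAdicEulerCharRankZeroNonsplitMult_zero_of_irr W₁ hirr₁) hmod hGZK hper₁ hgap hr₁ hmult₁ hns₁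
  exact missingUpperBoundAt_two_of_isogenous_member hmod hGZK hCassels W hr W₁ hiso hU₁

end Summit.BirchSwinnertonDyer.BirchSwinnertonDyer.Theorems

end
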